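import Mathlib
import HarnessLib
import Summits.CriticalPhenomena.CardyFormulaZ2.Theorems.CardyMagicRigidityMagicFormulaTExistsLimitA1sqBand
import Summits.CriticalPhenomena.CardyFormulaZ2.Theorems.CardyMagicRigidityMagicFormulaTCloseComparisonMatching
import Literature.MathematicalPhysics.KineticTheory.TaggedSphereDiffusionProofs
import Literature.Analysis.FunctionSpaces.SquaredBesselExistence

/-!
# Existence of `lim_δ E_{1/2}[A₁²]` modulo CN + SW — part 1b/3: the UV step and the uniform moments
(crux `MagicFormulaT`, line `Sketch` v10, sub-goal `el_existsLimitA1sq_of_facts`)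

Crux `Summit.CriticalPhenomena.CardyFormulaZ2.Theses.CardyMagicRigidity.MagicFormulaT`
(stmt-CriticalPhenomena-4836), line `Sketch`, skeleton v10, wave 5, registered sub-goal
`el_existsLimitA1sq_of_facts`: modulo Camia–Newman and Smirnov–Werner the limit of `E_{1/2}[A₁²]`,
`A₁ = Σ_u θ_u` (`θ_u = u.nestingPhase f`, loops of `siteLoopConfig δ ω` under `triSitePercolation half`),
exists as `δ → 0⁺`.  This file is the UV half of the Cauchy argument (registered helper `ela1_uv`).

Notation.  `X_t = Σ_{u ∈ bigLoops t} θ_u` (big-loop phase sum), `Θ_t = Σ_{diam u < t} θ_u` (band sum), so that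
pathwise `A₁ = Θ_t + X_t` (`ela1_finsum_split`, part 1a); thresholds `η_j = η/2 + (j+1)η/(2m) ∈ (η/2, η]`, `j < m`,
and `X̄ = m⁻¹ Σ_j X_{η_j} = A₁ − Θ̄`, `Θ̄ = m⁻¹ Σ_j Θ_{η_j}`.

`ela1_uv` (registered): given `κ > 0` there are `η₀ ≤ 1`, `B`, `δ₀` with, for `η ≤ η₀`, `m ≥ 1`,
`δ ≤ min(δ₀, η/2)`: `A₁²`, `X̄²`, `X̄⁴` integrable, `E X̄⁴ ≤ B`, and `|E A₁² − E X̄²| ≤ κ`.  Proof: `E e^{±A₁} ≤ M`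
for small `δ` (`ap_expMoment_powerSums`) gives `E A₁² ≤ S`, `E A₁⁴ ≤ 24 S`; the band moments of part 1a
(`ela1_bandMoments`: `E Θ_t² ≤ 2(e^{ct} − 1)`, `E Θ_t⁴ ≤ 48 e^{ct}`, `c = K₀(πC)²(|R|+2)³`, `δ ≤ t ≤ 1`) and
`Θ̄² ≤ m⁻¹Σ Θ_{η_j}²` (`el_sq_avg_le`) give `E Θ̄² ≤ 2(e^{cη} − 1)`; `X̄⁴ ≤ m⁻¹ Σ (A₁ − Θ_{η_j})⁴ ≤
m⁻¹ Σ 8(A₁⁴ + Θ_{η_j}⁴)` gives `E X̄⁴ ≤ 8(24S + 48e^c) =: B`; finally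
`|A₁² − X̄²| = |Θ̄|·|2A₁ − Θ̄| ≤ (s/2)Θ̄² + (2A₁ − Θ̄)²/(2s)` (`uva_abs_mul_le`) with `s = (8S + 2U₁ + 1)/κ`,
`U₁ = 2(e^c − 1)`, and `η₀ = min(1, log(1 + κ/(2s))/(c+1))`, so that `2(e^{cη₀} − 1) ≤ κ/s`.

No definition, no cited fact; tree material only.
-/

noncomputable section

namespace Summit.CriticalPhenomena.CardyFormulaZ2.Cruxes.MagicFormulaT.LineSketch

open MeasureTheory Filter Set Metric
open scoped Real Topology BigOperators ENNReal
open Literature.Probability.RandomPlanarGeometry Literature.Probability.Percolation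
  Literature.Probability.LatticeModels
open Summit.CriticalPhenomena.CardyFormulaZ2.Cruxes.NestingRigidity.RingCloudTomography
open Summit.CriticalPhenomena.CardyFormulaZ2.Cruxes.NestingRigidity.PositiveConeWeightDoubling

/-- **Registered helper `ela1_uv` (sub-goal of `el_existsLimitA1sq_of_facts`, line `Sketch` v10): the UV step and
the uniform moments for `E[A₁²]`.**  For an admissible density and `κ > 0` there are `η₀ ∈ (0, 1]`, `B > 0`,
`δ₀ > 0` such that for every `η ∈ (0, η₀]`, `m ≥ 1` and mesh `0 < δ ≤ min(δ₀, η/2)`: `A₁²`, `X̄²` and `X̄⁴` are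
integrable, `E X̄⁴ ≤ B`, and `|E A₁² − E X̄²| ≤ κ`, where `X̄ = m⁻¹ Σ_{j<m} Σ_{u ∈ bigLoops η_j} θ_u`,
`η_j = η/2 + (j+1)η/(2m)`.  See the module docstring for the proof. -/
theorem ela1_uv : ∀ (f : ℂ → ℝ) (R C : ℝ), Measurable f → (∀ z, |f z| ≤ C) → (∀ z, R < ‖z‖ → f z = 0) →
    ∫ z, f z = 0 → ∀ κ : ℝ, 0 < κ → ∃ η₀ B δ₀ : ℝ, 0 < η₀ ∧ η₀ ≤ 1 ∧ 0 < B ∧ 0 < δ₀ ∧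
    ∀ (η : ℝ) (m : ℕ) (δ : ℝ), 0 < η → η ≤ η₀ → 1 ≤ m → 0 < δ → δ ≤ δ₀ → δ ≤ η / 2 →
      Integrable (fun ω ↦ (∑ᶠ u ∈ (siteLoopConfig δ ω).loops, u.nestingPhase f) ^ 2)
        (triSitePercolation half) ∧
      Integrable (fun ω ↦ ((∑ j ∈ Finset.range m, ∑ᶠ u ∈ (siteLoopConfig δ ω).bigLoops
        (η / 2 + ((j : ℝ) + 1) * η / (2 * m)), u.nestingPhase f) / m) ^ 2) (triSitePercolation half) ∧
      Integrable (fun ω ↦ (((∑ j ∈ Finset.range m, ∑ᶠ u ∈ (siteLoopConfig δ ω).bigLoops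
        (η / 2 + ((j : ℝ) + 1) * η / (2 * m)), u.nestingPhase f) / m) ^ 2) ^ 2) (triSitePercolation half) ∧
      ∫ ω, (((∑ j ∈ Finset.range m, ∑ᶠ u ∈ (siteLoopConfig δ ω).bigLoops
        (η / 2 + ((j : ℝ) + 1) * η / (2 * m)), u.nestingPhase f) / m) ^ 2) ^ 2 ∂(triSitePercolation half) ≤
        B ∧
      |∫ ω, (∑ᶠ u ∈ (siteLoopConfig δ ω).loops, u.nestingPhase f) ^ 2 ∂(triSitePercolation half) -
        ∫ ω, ((∑ j ∈ Finset.range m, ∑ᶠ u ∈ (siteLoopConfig δ ω).bigLoops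
          (η / 2 + ((j : ℝ) + 1) * η / (2 * m)), u.nestingPhase f) / m) ^ 2 ∂(triSitePercolation half)| ≤
        κ := by
  intro f R C hf hC hR h0 κ hκ
  have hC0 : 0 ≤ C := nonneg_of_abs_le hC
  set P : Measure (SiteConfig (Site 2)) := triSitePercolation half with hPdef
  -- exponential moments of `A₁` at `s = ±1`
  obtain ⟨M₁, hM₁⟩ := ap_expMoment_powerSums f R C hf hC hR h0 1
  obtain ⟨M₂, hM₂⟩ := ap_expMoment_powerSums f R C hf hC hR h0 (-1)
  obtain ⟨δ₁, hδ₁, h₁⟩ := el_exists_Ioo_of_eventually hM₁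
  obtain ⟨δ₂, hδ₂, h₂⟩ := el_exists_Ioo_of_eventually hM₂
  clear hM₁ hM₂
  -- band moments
  obtain ⟨K₀, hK₀, hband⟩ := ela1_bandMoments f R C hf hC hR h0
  set c : ℝ := K₀ * (π * C) ^ 2 * (|R| + 2) ^ 3 with hcdef
  have hc0 : 0 ≤ c := by positivity
  -- constants
  set S : ℝ := max (M₁ + M₂) 1 with hSdef
  have hS0 : 0 < S := lt_of_lt_of_le one_pos (le_max_right _ _)
  have hMS : M₁ + M₂ ≤ S := le_max_left _ _
  set U₁ : ℝ := 2 * (Real.exp c - 1) with hU₁def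
  have hU₁0 : 0 ≤ U₁ := by
    have : 1 ≤ Real.exp c := Real.one_le_exp hc0
    rw [hU₁def]; linarith
  set s : ℝ := (8 * S + 2 * U₁ + 1) / κ with hsdef
  have hs : 0 < s := by positivity
  set target : ℝ := κ / s with htdef
  have htarget : 0 < target := by positivity
  set η₀ : ℝ := min 1 (Real.log (1 + target / 2) / (c + 1)) with hη₀def
  have hlogpos : 0 < Real.log (1 + target / 2) := Real.log_pos (by linarith)
  have hη₀ : 0 < η₀ := lt_min one_pos (by positivity)
  have hUVsmall : ∀ η : ℝ, 0 < η → η ≤ η₀ → 2 * (Real.exp (c * η) - 1) ≤ target := by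
    intro η hη hηle
    have h1 : η ≤ Real.log (1 + target / 2) / (c + 1) := hηle.trans (min_le_right _ _)
    have h2 : c * η ≤ Real.log (1 + target / 2) := by
      rw [le_div_iff₀ (by positivity)] at h1
      nlinarith
    have h3 : Real.exp (c * η) ≤ 1 + target / 2 := by
      calc Real.exp (c * η) ≤ Real.exp (Real.log (1 + target / 2)) := Real.exp_le_exp.2 h2
        _ = 1 + target / 2 := Real.exp_log (by positivity)
    linarith
  set B : ℝ := 8 * (24 * S + 48 * Real.exp c) with hBdef
  have hB : 0 < B := by positivity
  refine ⟨η₀, B, min δ₁ δ₂ / 2, hη₀, min_le_left _ _, hB, by positivity, ?_⟩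
  intro η m δ hη hηle hm hδ hδle hδη
  have hη1 : η ≤ 1 := hηle.trans (min_le_left _ _)
  have hmpos : (0 : ℝ) < m := by exact_mod_cast hm
  have hδ1' : δ < δ₁ := by
    have := min_le_left δ₁ δ₂; linarith
  have hδ2' : δ < δ₂ := by
    have := min_le_right δ₁ δ₂; linarith
  obtain ⟨hIe₁, hEe₁, -, -⟩ := h₁ δ hδ hδ1'
  obtain ⟨hIe₂, hEe₂, -, -⟩ := h₂ δ hδ hδ2'
  clear h₁ h₂
  simp only [one_mul] at hIe₁ hEe₁
  simp only [neg_one_mul] at hIe₂ hEe₂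
  -- notation
  set A : SiteConfig (Site 2) → ℝ := fun ω ↦ ∑ᶠ u ∈ (siteLoopConfig δ ω).loops, u.nestingPhase f
    with hAdef
  set thr : ℕ → ℝ := fun j ↦ η / 2 + ((j : ℝ) + 1) * η / (2 * m) with hthrdef
  set Θ : ℕ → SiteConfig (Site 2) → ℝ := fun j ω ↦
    ∑ᶠ u ∈ {u ∈ (siteLoopConfig δ ω).loops | diam u.range < thr j}, u.nestingPhase f with hΘdef
  set X : ℕ → SiteConfig (Site 2) → ℝ := fun j ω ↦
    ∑ᶠ u ∈ (siteLoopConfig δ ω).bigLoops (thr j), u.nestingPhase f with hXdef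
  set Xbar : SiteConfig (Site 2) → ℝ := fun ω ↦ (∑ j ∈ Finset.range m, X j ω) / m with hXbardef
  set Θbar : SiteConfig (Site 2) → ℝ := fun ω ↦ (∑ j ∈ Finset.range m, Θ j ω) / m with hΘbardef
  have hIe₁' : Integrable (fun ω ↦ Real.exp (A ω)) P := hIe₁
  have hIe₂' : Integrable (fun ω ↦ Real.exp (-A ω)) P := hIe₂
  have hEe₁' : ∫ ω, Real.exp (A ω) ∂P ≤ M₁ := hEe₁
  have hEe₂' : ∫ ω, Real.exp (-A ω) ∂P ≤ M₂ := hEe₂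
  -- thresholds
  have hthr : ∀ j ∈ Finset.range m, δ ≤ thr j ∧ thr j ≤ η := by
    intro j hj
    refine ⟨?_, cc_threshold_le hη.le hj⟩
    have : 0 ≤ ((j : ℝ) + 1) * η / (2 * m) := by positivity
    exact hδη.trans (le_add_of_nonneg_right this)
  -- the split `A = Θ_j + X_j`, so `X̄ = A − Θ̄`
  have hsplit : ∀ j ω, A ω = Θ j ω + X j ω := fun j ω ↦ ela1_finsum_split hR h0 hδ ω (thr j)
  have hXbar : ∀ ω, Xbar ω = A ω - Θbar ω := fun ω ↦
    ela1_avg_eq_sub hmpos (a := fun j ↦ X j ω) (b := fun j ↦ Θ j ω) fun j _ ↦ hsplit j ω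
  -- measurability
  have hmA : Measurable A := FirstMoment.measurable_finsum_loops tEns tEns_mem δ _
  have hmΘ : ∀ j, Measurable (Θ j) := fun j ↦
    FirstMoment.measurable_finsum_loops_sep tEns tEns_mem δ (fun u ↦ diam u.range < thr j) _
  have hmX : Measurable Xbar := ela1_measurable_avg f δ η m
  have hmΘbar : Measurable Θbar := (Finset.measurable_sum _ fun j _ ↦ hmΘ j).div_const _
  -- band moments at the thresholds
  have hbm : ∀ j ∈ Finset.range m,
      Integrable (fun ω ↦ Θ j ω ^ 2) P ∧ ∫ ω, Θ j ω ^ 2 ∂P ≤ 2 * (Real.exp (c * η) - 1) ∧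
      Integrable (fun ω ↦ Θ j ω ^ 4) P ∧ ∫ ω, Θ j ω ^ 4 ∂P ≤ 48 * Real.exp c := by
    intro j hj
    obtain ⟨hI2, hE2, hI4, hE4⟩ := hband δ (thr j) hδ (hthr j hj).1 ((hthr j hj).2.trans hη1)
    have hcj : K₀ * (π * C) ^ 2 * (|R| + 2) ^ 3 * thr j ≤ c * η := by
      rw [hcdef]; exact mul_le_mul_of_nonneg_left (hthr j hj).2 hc0
    have hcj' : K₀ * (π * C) ^ 2 * (|R| + 2) ^ 3 * thr j ≤ c := by
      refine hcj.trans ?_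
      rw [hcdef]; exact mul_le_of_le_one_right hc0 hη1
    exact ⟨hI2, hE2.trans (mul_le_mul_of_nonneg_left (sub_le_sub_right (Real.exp_le_exp.2 hcj) 1) two_pos.le),
      hI4, hE4.trans (mul_le_mul_of_nonneg_left (Real.exp_le_exp.2 hcj') (by norm_num))⟩
  clear hband
  -- moments of `A`
  have hIsumA : Integrable (fun ω ↦ Real.exp (A ω) + Real.exp (-A ω)) P := hIe₁'.add hIe₂'
  have hEsumA : ∫ ω, (Real.exp (A ω) + Real.exp (-A ω)) ∂P ≤ S := by
    rw [integral_add hIe₁' hIe₂']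
    exact (add_le_add hEe₁' hEe₂').trans hMS
  have hsqA : ∀ ω, A ω ^ 2 ≤ Real.exp (A ω) + Real.exp (-A ω) := fun ω ↦
    (ela1_sq_le_exp_add _).trans (sub_le_self _ zero_le_two)
  have hIA2 : Integrable (fun ω ↦ A ω ^ 2) P :=
    hIsumA.mono' (hmA.pow_const 2).aestronglyMeasurable (Eventually.of_forall fun ω ↦ by
      rw [Real.norm_eq_abs, abs_of_nonneg (sq_nonneg _)]
      exact hsqA ω)
  have hEA2 : ∫ ω, A ω ^ 2 ∂P ≤ S := (integral_mono hIA2 hIsumA hsqA).trans hEsumA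
  have hIA4 : Integrable (fun ω ↦ A ω ^ 4) P :=
    (hIsumA.const_mul 24).mono' (hmA.pow_const 4).aestronglyMeasurable (Eventually.of_forall fun ω ↦ by
      rw [Real.norm_eq_abs, abs_of_nonneg (by positivity)]
      exact Literature.MathematicalPhysics.QuantumFieldTheory.pow_four_le_exp_add_exp_neg _)
  have hEA4 : ∫ ω, A ω ^ 4 ∂P ≤ 24 * S := by
    calc ∫ ω, A ω ^ 4 ∂P ≤ ∫ ω, 24 * (Real.exp (A ω) + Real.exp (-A ω)) ∂P :=
          integral_mono hIA4 (hIsumA.const_mul 24) fun ω ↦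
            Literature.MathematicalPhysics.QuantumFieldTheory.pow_four_le_exp_add_exp_neg _
      _ = 24 * ∫ ω, (Real.exp (A ω) + Real.exp (-A ω)) ∂P := integral_const_mul _ _
      _ ≤ 24 * S := mul_le_mul_of_nonneg_left hEsumA (by norm_num)
  -- moments of `Θ̄`
  have hΘbar_dom : ∀ ω, Θbar ω ^ 2 ≤ (∑ j ∈ Finset.range m, Θ j ω ^ 2) / (m : ℝ) := fun ω ↦
    el_sq_avg_le (m := m) fun j ↦ Θ j ω
  have hIΘsum : Integrable (fun ω ↦ (∑ j ∈ Finset.range m, Θ j ω ^ 2) / (m : ℝ)) P :=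
    (integrable_finsetSum _ fun j hj ↦ (hbm j hj).1).div_const _
  have hIΘbar2 : Integrable (fun ω ↦ Θbar ω ^ 2) P :=
    hIΘsum.mono' (hmΘbar.pow_const 2).aestronglyMeasurable (Eventually.of_forall fun ω ↦ by
      rw [Real.norm_eq_abs, abs_of_nonneg (sq_nonneg _)]
      exact hΘbar_dom ω)
  have hEΘbar2 : ∫ ω, Θbar ω ^ 2 ∂P ≤ 2 * (Real.exp (c * η) - 1) := by
    calc ∫ ω, Θbar ω ^ 2 ∂P ≤ ∫ ω, (∑ j ∈ Finset.range m, Θ j ω ^ 2) / (m : ℝ) ∂P :=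
          integral_mono hIΘbar2 hIΘsum hΘbar_dom
      _ = (∑ j ∈ Finset.range m, ∫ ω, Θ j ω ^ 2 ∂P) / (m : ℝ) := by
          rw [integral_div, integral_finsetSum _ fun j hj ↦ (hbm j hj).1]
      _ ≤ (∑ _j ∈ Finset.range m, 2 * (Real.exp (c * η) - 1)) / (m : ℝ) :=
          div_le_div_of_nonneg_right (Finset.sum_le_sum fun j hj ↦ (hbm j hj).2.1) hmpos.le
      _ = 2 * (Real.exp (c * η) - 1) := ela1_avg_const hmpos _
  have hUVη : 2 * (Real.exp (c * η) - 1) ≤ target := hUVsmall η hη hηle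
  have hUVU : 2 * (Real.exp (c * η) - 1) ≤ U₁ :=
    mul_le_mul_of_nonneg_left (sub_le_sub_right (Real.exp_le_exp.2 (mul_le_of_le_one_right hc0 hη1)) 1)
      two_pos.le
  -- `X̄²` is integrable
  have hImaj2 : Integrable (fun ω ↦ 2 * A ω ^ 2 + 2 * Θbar ω ^ 2) P :=
    (hIA2.const_mul 2).add (hIΘbar2.const_mul 2)
  have hIX2 : Integrable (fun ω ↦ Xbar ω ^ 2) P :=
    hImaj2.mono' (hmX.pow_const 2).aestronglyMeasurable (Eventually.of_forall fun ω ↦ by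
      rw [Real.norm_eq_abs, abs_of_nonneg (sq_nonneg _), hXbar ω]
      exact Literature.MathematicalPhysics.KineticTheory.sub_sq_le_two_mul_sq_add _ _)
  -- `X̄⁴` is integrable with `E X̄⁴ ≤ B`
  have hX4dom : ∀ ω, (Xbar ω ^ 2) ^ 2 ≤ (∑ j ∈ Finset.range m, 8 * (A ω ^ 4 + Θ j ω ^ 4)) / (m : ℝ) := by
    intro ω
    calc (Xbar ω ^ 2) ^ 2 = ((∑ j ∈ Finset.range m, X j ω) / (m : ℝ)) ^ 4 := by rw [hXbardef]; ring
      _ ≤ (∑ j ∈ Finset.range m, X j ω ^ 4) / (m : ℝ) := ela1_pow_four_avg_le (m := m) fun j ↦ X j ω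
      _ ≤ (∑ j ∈ Finset.range m, 8 * (A ω ^ 4 + Θ j ω ^ 4)) / (m : ℝ) := by
          refine div_le_div_of_nonneg_right (Finset.sum_le_sum fun j _ ↦ ?_) hmpos.le
          rw [eq_sub_of_add_eq' (hsplit j ω).symm]
          exact Literature.Analysis.FunctionSpaces.pow_four_sub_le _ _
  have hIj : ∀ j ∈ Finset.range m, Integrable (fun ω ↦ 8 * (A ω ^ 4 + Θ j ω ^ 4)) P := fun j hj ↦
    (hIA4.add (hbm j hj).2.2.1).const_mul 8
  have hImaj4 : Integrable (fun ω ↦ (∑ j ∈ Finset.range m, 8 * (A ω ^ 4 + Θ j ω ^ 4)) / (m : ℝ)) P :=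
    (integrable_finsetSum _ hIj).div_const _
  have hIX4 : Integrable (fun ω ↦ (Xbar ω ^ 2) ^ 2) P :=
    hImaj4.mono' ((hmX.pow_const 2).pow_const 2).aestronglyMeasurable (Eventually.of_forall fun ω ↦ by
      rw [Real.norm_eq_abs, abs_of_nonneg (sq_nonneg _)]
      exact hX4dom ω)
  have hEX4 : ∫ ω, (Xbar ω ^ 2) ^ 2 ∂P ≤ B := by
    calc ∫ ω, (Xbar ω ^ 2) ^ 2 ∂P ≤ ∫ ω, (∑ j ∈ Finset.range m, 8 * (A ω ^ 4 + Θ j ω ^ 4)) / (m : ℝ) ∂P :=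
          integral_mono hIX4 hImaj4 hX4dom
      _ = (∑ j ∈ Finset.range m, 8 * (∫ ω, A ω ^ 4 ∂P + ∫ ω, Θ j ω ^ 4 ∂P)) / (m : ℝ) := by
          rw [integral_div, integral_finsetSum _ hIj]
          congr 1
          refine Finset.sum_congr rfl fun j hj ↦ ?_
          rw [integral_const_mul, integral_add hIA4 (hbm j hj).2.2.1]
      _ ≤ (∑ _j ∈ Finset.range m, 8 * (24 * S + 48 * Real.exp c)) / (m : ℝ) := by
          refine div_le_div_of_nonneg_right (Finset.sum_le_sum fun j hj ↦ ?_) hmpos.le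
          exact mul_le_mul_of_nonneg_left (add_le_add hEA4 (hbm j hj).2.2.2) (by norm_num)
      _ = B := ela1_avg_const hmpos _
  -- the UV difference
  have hptw : ∀ ω, |A ω ^ 2 - Xbar ω ^ 2| ≤ s / 2 * Θbar ω ^ 2 + 1 / (2 * s) * (2 * A ω - Θbar ω) ^ 2 := by
    intro ω
    rw [hXbar ω]
    exact ela1_abs_sq_sub_sq_le hs _ _
  have hImaj8 : Integrable (fun ω ↦ 8 * A ω ^ 2 + 2 * Θbar ω ^ 2) P :=
    (hIA2.const_mul 8).add (hIΘbar2.const_mul 2)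
  have hsq8 : ∀ ω, (2 * A ω - Θbar ω) ^ 2 ≤ 8 * A ω ^ 2 + 2 * Θbar ω ^ 2 := fun ω ↦
    ela1_sq_two_mul_sub_le _ _
  have hI2AΘ : Integrable (fun ω ↦ (2 * A ω - Θbar ω) ^ 2) P :=
    hImaj8.mono' (((hmA.const_mul 2).sub hmΘbar).pow_const 2).aestronglyMeasurable
      (Eventually.of_forall fun ω ↦ by
        rw [Real.norm_eq_abs, abs_of_nonneg (sq_nonneg _)]
        exact hsq8 ω)
  have hE2AΘ : ∫ ω, (2 * A ω - Θbar ω) ^ 2 ∂P ≤ 8 * S + 2 * U₁ := by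
    calc ∫ ω, (2 * A ω - Θbar ω) ^ 2 ∂P ≤ ∫ ω, (8 * A ω ^ 2 + 2 * Θbar ω ^ 2) ∂P :=
          integral_mono hI2AΘ hImaj8 hsq8
      _ = 8 * ∫ ω, A ω ^ 2 ∂P + 2 * ∫ ω, Θbar ω ^ 2 ∂P := by
          rw [integral_add (hIA2.const_mul 8) (hIΘbar2.const_mul 2), integral_const_mul, integral_const_mul]
      _ ≤ 8 * S + 2 * U₁ :=
          add_le_add (mul_le_mul_of_nonneg_left hEA2 (by norm_num))
            (mul_le_mul_of_nonneg_left (hEΘbar2.trans hUVU) two_pos.le)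
  have hImaj : Integrable (fun ω ↦ s / 2 * Θbar ω ^ 2 + 1 / (2 * s) * (2 * A ω - Θbar ω) ^ 2) P :=
    (hIΘbar2.const_mul _).add (hI2AΘ.const_mul _)
  have e1 : s / 2 * target = κ / 2 := by
    rw [htdef]; field_simp
  have e2 : 1 / (2 * s) * (8 * S + 2 * U₁) ≤ κ / 2 := by
    have hden : 0 < 8 * S + 2 * U₁ + 1 := by positivity
    have e3 : 1 / (2 * s) * (8 * S + 2 * U₁) = κ / 2 * ((8 * S + 2 * U₁) / (8 * S + 2 * U₁ + 1)) := by
      rw [hsdef]; field_simp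
    have e4 : (8 * S + 2 * U₁) / (8 * S + 2 * U₁ + 1) ≤ 1 := by
      rw [div_le_one hden]; exact (lt_add_one _).le
    rw [e3]
    calc κ / 2 * ((8 * S + 2 * U₁) / (8 * S + 2 * U₁ + 1)) ≤ κ / 2 * 1 :=
          mul_le_mul_of_nonneg_left e4 (by positivity)
      _ = κ / 2 := mul_one _
  have hdiff : |∫ ω, A ω ^ 2 ∂P - ∫ ω, Xbar ω ^ 2 ∂P| ≤ κ := by
    calc |∫ ω, A ω ^ 2 ∂P - ∫ ω, Xbar ω ^ 2 ∂P| = |∫ ω, (A ω ^ 2 - Xbar ω ^ 2) ∂P| := by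
          rw [integral_sub hIA2 hIX2]
      _ ≤ ∫ ω, |A ω ^ 2 - Xbar ω ^ 2| ∂P := abs_integral_le_integral_abs
      _ ≤ ∫ ω, (s / 2 * Θbar ω ^ 2 + 1 / (2 * s) * (2 * A ω - Θbar ω) ^ 2) ∂P :=
          integral_mono (hIA2.sub hIX2).abs hImaj hptw
      _ = s / 2 * ∫ ω, Θbar ω ^ 2 ∂P + 1 / (2 * s) * ∫ ω, (2 * A ω - Θbar ω) ^ 2 ∂P := by
          rw [integral_add (hIΘbar2.const_mul _) (hI2AΘ.const_mul _), integral_const_mul,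
            integral_const_mul]
      _ ≤ s / 2 * target + 1 / (2 * s) * (8 * S + 2 * U₁) :=
          add_le_add (mul_le_mul_of_nonneg_left (hEΘbar2.trans hUVη) (by positivity))
            (mul_le_mul_of_nonneg_left hE2AΘ (by positivity))
      _ = κ / 2 + 1 / (2 * s) * (8 * S + 2 * U₁) := by rw [e1]
      _ ≤ κ / 2 + κ / 2 := add_le_add le_rfl e2
      _ = κ := by ring
  exact ⟨hIA2, hIX2, hIX4, hEX4, hdiff⟩

end Summit.CriticalPhenomena.CardyFormulaZ2.Cruxes.MagicFormulaT.LineSketch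

end
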